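import Summits.FinalStateConjecture.FinalStateConjecture.Theorems.StarvedNecksNecksCertifyRRelations
import HarnessLib.Audit

/-!
# Birth skeleton (BC3) — crux `StarvedNecks.GapDecaySuffices` (stmt-FinalStateConjecture-18060)

Registrar: planner-skel-stmt-FinalStateConjecture-18060-0, 2026-08-17 (route re-audit bin REPAIRABLE;
published as `Cruxes/GapDecaySuffices/Lines/birth.lean`).  The crux is FIXED and concluded BY NAME:

  `Summit.FinalStateConjecture.FinalStateConjecture.Theses.StarvedNecks.GapDecaySuffices`
  `:= NeckGapDecay → NecksCertifyR`   (the GAUGE half of the route's deciding crux S).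

## The cut (three named stubs, composition kernel-checked)

Everything downstream of the v5 `NeckCertificate` (K1–K12: analysis walls `ρₐ`, certified radii `Rc`,
re-gauged hole charts `Ψₐ` with ONE ATLAS against the input's undrifted flat chart beyond `4ρₐ`, `C²`
certification, `C⁰` honesty, future lines, image-disjoint tubes, relative closedness, causal covering) is
LANDED: `…Theorems.NecksCertifyRRelations.necksCertifyR_of_neckLedgerAnalysisPos` (p131681, std axioms)
turns "every honest input with `0 < d.N` and distinct velocities has a `NeckCertificate`" into
`NecksCertifyR`.  So `GapDecaySuffices` is: gap certificates (the conclusion of `NeckGapDecay`) ⟹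
`NeckCertificate`, for every honest input.  This file cuts that implication along the three objects
every re-gauging line of this crux consumes (crux dossier: Cruxes/GapDecaySuffices/Ideas/*, PICKED.md,
NegativeNotes-…-r1k1.md; refuter crux-attack 2026-08-17T00:28Z):

* `stub_reExcisionBootstrap` (M, provable now — the refuter's kernel-checked `ReExcise.lean` device,
  re-typed against this file's bundles): `NeckGapDecay → ThickWallCertificates`.  Because `NeckGapDecay`
  quantifies over ALL `C⁴` decompositions, it can be applied to the SAME charts with any larger sublinear
  excision profile `ϱ ≥ ρ` (`FinalStateDecomposition.excision` is a free field constrained only by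
  `tendsto_excision_div` and the antitone clause `setOf_lt_excision_subset_flatDomain`; `Hc`, DV, `O`,
  `charted` do not mention it and `Hf`(2) is antitone in it), so every hole carries gap certificates with
  wall `W ≥ 3ϱ + 2` for EVERY sublinear majorant `ϱ` of its excision radius: the LOG-ROOM supplier
  (`W/ρ → ∞` at will) that every blend needs against the unbounded relative rotation / drift / slow boost of
  honest gauges (AUDIT-c4 (A)(B)(C); vortex (D) and flash (E) of the negative notes).
* `stub_firstContact` (L, causal/topological, no PDE — THE ANCHOR): for every honest input, thick-wall
  certificates can be chosen so that every late certified slab `{tᵢ = τ, rᵢ ≤ W}` of the gap chart MEETS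
  THE RADIATION ZONE `Φ(late flat domain)`.  This is the one existence statement no clause of G1–G5 / `Hc` /
  `Hf` / the structure names (card `curvature-anchored-location` §(2), card `neck-timeline-anchoring` §(3):
  "the anchor is isolated as the one step without an evident typed handle"); from ONE contact point,
  anchored clopen continuation along the connected late band (open: `Φ` is an open embedding; closed:
  `Hf`(2), G5; exclusion: Kretschmann marker) yields ENTRY (`T := Φ⁻¹ ∘ Ψg` defined on a thick band),
  THREADING and the kinematic majorants.  Stated constant-free and EXISTENTIALLY in the certificate (only
  lower bounds on `W`), so that erratic excision profiles and honest clock offsets `o(τ)` between the hole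
  and flat clocks are absorbed by choosing the majorant, never by the statement.  If an honest
  "two-sheeted" input refutes it, the crux is MISSTATED and the recorded repair is the image clause G6 in
  `NeckGapDecay` (kill criterion (3) of the route; refuter ATTACK.md; both location cards), after which
  this stub is immediate — a decision either way.
* `stub_contactedSeam` (XL, the gauge geometry proper): for every honest input with `0 < d.N`, contacted
  thick-wall certificates for all majorants ⟹ `NeckCertificate`.  Contents (never items, D-0019):
  ENTRY/THREADING/velocity decay from the contact points; the switch-off of ONE near-`η`-isometry with `C²`
  control inside the group (mean-frame Stokes rigidity + in-group/Whitney blending with the bootstrap's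
  log-room — NOT the refuted pointwise devices: no sup-`C¹` closeness of `T` to a Poincaré map, no
  pointwise `‖DT‖` bound, no all-scale mollified seam; NegativeNotes (D)(E)); chart assembly K4–K9; and the
  causal bookkeeping K10–K12 by transport (cone separation p106992 is where DV enters; `Hc`(2)(3), `Hf`(1)(2),
  G4/G5).  The lead's line (`Lines/Sketch.lean`, PICKED.md) cuts this stub further; here it is one named
  piece so that the two upstream objects are certified separately.

`GapDecaySuffices_of : stub₁-sig → stub₂-sig → stub₃-sig → GapDecaySuffices` is PROVED below (pure logic over
p131681; the bundles `HonestCore` / `HonestFar` / `NeckCertificate` are token-identical copies of the landed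
reduction's `let`-bundles, and `GapCert … (d.excision i) …` is token-identical to the `∃`-body of
`NeckGapDecay`, so every hand-over is definitional).  `lean check`: sorries ONLY in the three `stub_*`.

Disproof used: none exists for this crux (no `Cruxes/GapDecaySuffices/Disproof.lean`, payload `disproof_path`
absent, 2026-08-17); the predecessor decl's `Cruxes/NecksCertify/Disproof.lean` has no `_false_without_`
theorem on the gauge half; its §B/§D (DV, `Hf`(3), tube containment) are honoured — DV is an antecedent
throughout and is consumed only in `stub_contactedSeam` (K10 via cone separation).  Landed Negative lemmas
(`ComovingPairWitness`, `EqualVelocityBinaryWitness`, `ParallelLabelsNoMoat`, `SeamedOneAtlasDeviation`,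
`SeamedExcisionUnbounded`) concern DV / one-atlas thresholds of the OUTPUT and are not instantiated by any stub.
-/

noncomputable section

open scoped Manifold ContDiff Topology ENNReal
open Filter Set MeasureTheory Topology Literature.Geometry.Lorentzian

namespace Summit.FinalStateConjecture.FinalStateConjecture.Cruxes.GapDecaySuffices.Birth

set_option linter.dupNamespace false
set_option linter.unusedVariables false

/-! ## The route's let-bound bundles, named (token-identical copies of p131681 / `NeckGapDecay`) -/

/-- `HonestCore` = the route's `Hc` (verbatim; identical to the `let HonestCore` of
`…NecksCertifyRRelations.necksCertifyR_of_neckLedgerAnalysisPos`): sub-extremal holes, `100·Mᵢ ≤ R₀`,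
orthochronous boosts; anchoring of hole-late points below later discs of every radius `≥ R₀`; relative
closedness of late tube portions; future-oriented flat chart. -/
def HonestCore (𝓢 : Spacetime.{0} 4) (O : Set 𝓢.carrier) (k : ℕ) (d : FinalStateDecomposition 𝓢 O k)
    (R₀ : ℝ) : Prop :=
  let B := d.background; let t := fun i ↦ (B i).time; let r := fun i ↦ (B i).radius; let Ψ := d.chart;
  (∀ i, Kerr.IsSubextremal (d.mass i) (d.spin i) ∧ 100 * d.mass i ≤ R₀ ∧ 0 < ((d.motion i).1 : E4 ≃L[ℝ] E4) (E4.basisVector 0) 0) ∧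
    (∀ i (ϱ τ₂ : ℝ), R₀ ≤ ϱ → d.τ₀ < τ₂ → Ψ i '' {x | d.τ₀ < t i x.1 ∧ t i x.1 < τ₂ ∧ r i x.1 < ϱ} ⊆ 𝓢.metric.causalPast 𝓢.timeOrientation (Ψ i '' (B i).truncTimeSlab ϱ τ₂)) ∧
    (∀ i (τ' : ℝ) (ϱ : ℝ → ℝ), Continuous ϱ → d.τ₀ < τ' → let A := Ψ i '' {x | τ' ≤ t i x.1 ∧ r i x.1 ≤ ϱ (t i x.1)}; closure A ∩ O ⊆ A) ∧
    (∀ y : d.flatDomain, d.τ₀ < y.1 0 → 𝓢.timeOrientation.IsFutureDirected (mfderiv 𝓘(ℝ, E4) (𝓡 4) d.flatChart y (E4.basisVector 0)))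

/-- `HonestFar` = the route's `Hf` (verbatim; identical to p131681's `let HonestFar`): flat-late points below
later flat slabs; closures of far flat slabs are flat points; eventually each hole chart is `C⁰`-honest
(`1/(10‖Λᵢ‖²)`) on its own Voronoi cell beyond `R₀`. -/
def HonestFar (𝓢 : Spacetime.{0} 4) (O : Set 𝓢.carrier) (k : ℕ) (d : FinalStateDecomposition 𝓢 O k)
    (R₀ : ℝ) : Prop :=
  let B := d.background; let t := fun i ↦ (B i).time; let r := fun i ↦ (B i).radius; let Φ := d.flatChart;
  (∀ τ₂ : ℝ, d.τ₀ < τ₂ → Φ '' {y | d.τ₀ < y.1 0 ∧ y.1 0 < τ₂} ⊆ 𝓢.metric.causalPast 𝓢.timeOrientation (Φ '' (Minkowski.backgroundOn d.flatDomain).timeSlab τ₂)) ∧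
    (∀ τ' : ℝ, d.τ₀ < τ' → closure (Φ '' {y | τ' ≤ y.1 0 ∧ ∀ i, d.excision i (y.1 0) + 1 ≤ r i y.1}) ⊆ Φ '' {y | τ' ≤ y.1 0}) ∧
    (∀ i, ∃ T : ℝ, supCkENorm (Subtype.val '' {x : (B i).domain | T ≤ t i x.1 ∧ R₀ ≤ r i x.1 ∧ ∀ j, j ≠ i → r i x.1 ≤ r j x.1}) 0 (𝓢.deviationExtend (B i) (d.chart i)) ≤ ENNReal.ofReal (1 / (10 * ‖(((d.motion i).1 : E4 ≃L[ℝ] E4) : E4 →L[ℝ] E4)‖ ^ 2)))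

/-- **DV** — pairwise distinct asymptotic four-velocities of the input's holes (the antecedent the route's
repair C′ inserted into `NecksCertifyR`; verbatim the inline conjunct of `NeckGapDecay` / p131681). -/
def DistinctVelocities {𝓢 : Spacetime.{0} 4} {O : Set 𝓢.carrier} {k : ℕ}
    (d : FinalStateDecomposition 𝓢 O k) : Prop :=
  ∀ i j : Fin d.N, i ≠ j →
    ((d.motion i).1 : E4 ≃L[ℝ] E4) (E4.basisVector 0) ≠ ((d.motion j).1 : E4 ≃L[ℝ] E4) (E4.basisVector 0)

/-- **Gap certificate of hole `i` with wall tied to the profile `ϱ`** — the `∃`-body of the route decl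
`NeckGapDecay` (G0 `R₀ ≤ R₁`, `τ₀ ≤ τ₁`, `W` continuous, WALL `3ϱ + 2 ≤ W` after `τ₁`; G1 `Ψg` smooth open
embedding of the late model tube `U = {τ₁ < tᵢ, rᵢ < W(x⁰)+1}` into `d.charted`; G2 `= Ψᵢ` inside `R₁+1`;
G3 sup-`C²` deviation from boosted Kerrᵢ on the slabs `{tᵢ = τ, rᵢ ≤ W(x⁰)}` `→ 0`; G4 future-directed
`Λᵢe₀`-lines on `R₁ ≤ rᵢ ≤ W`; G5 relatively closed sub-wall late tube portions), with the input's
excision radius `d.excision i` generalised to an arbitrary profile `ϱ`.  With `ϱ := d.excision i` it is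
token-identical to `NeckGapDecay`'s body, so `NeckGapDecay` hands over by `exact`. -/
def GapCert (𝓢 : Spacetime.{0} 4) (O : Set 𝓢.carrier) (d : FinalStateDecomposition 𝓢 O 4) (R₀ : ℝ)
    (ϱ : ℝ → ℝ) (i : Fin d.N) (R₁ τ₁ : ℝ) (W : ℝ → ℝ)
    (Ψg : (d.background i).domain → 𝓢.carrier) : Prop :=
  let B := d.background i; let t := B.time; let r := B.radius;
  R₀ ≤ R₁ ∧ d.τ₀ ≤ τ₁ ∧ Continuous W ∧ (∀ s, τ₁ ≤ s → 3 * ϱ s + 2 ≤ W s) ∧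
    (let U : Set B.domain := {x | τ₁ < t x.1 ∧ r x.1 < W (x.1 0) + 1};
      ContMDiffOn 𝓘(ℝ, E4) (𝓡 4) ∞ Ψg U ∧ Topology.IsOpenEmbedding (U.restrict Ψg) ∧ Ψg '' U ⊆ d.charted) ∧
    (∀ x : B.domain, r x.1 ≤ R₁ + 1 → Ψg x = d.chart i x) ∧
    Tendsto (fun τ ↦ supCkENorm (Subtype.val '' {x : B.domain | t x.1 = τ ∧ r x.1 ≤ W (x.1 0)}) 2
      (𝓢.deviationExtend B Ψg)) atTop (𝓝 0) ∧
    (∀ x : B.domain, τ₁ ≤ t x.1 → R₁ ≤ r x.1 → r x.1 ≤ W (x.1 0) →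
      𝓢.timeOrientation.IsFutureDirected
        (mfderiv 𝓘(ℝ, E4) (𝓡 4) Ψg x (((d.motion i).1 : E4 ≃L[ℝ] E4) (E4.basisVector 0)))) ∧
    (∀ (τ' : ℝ) (ϱ' : ℝ → ℝ), Continuous ϱ' → τ₁ < τ' →
      (∀ x : B.domain, τ' ≤ t x.1 → r x.1 ≤ ϱ' (t x.1) → r x.1 ≤ W (x.1 0)) →
      closure (Ψg '' {x | τ' ≤ t x.1 ∧ r x.1 ≤ ϱ' (t x.1)}) ∩ O ⊆
        Ψg '' {x | τ' ≤ t x.1 ∧ r x.1 ≤ ϱ' (t x.1)})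

/-- **First contact** of the certificate `(τ₁, W, Ψg)` of hole `i`: every late certified slab
`{tᵢ = τ, rᵢ ≤ W(x⁰)}` (`τ > τ₁`) contains a point whose `Ψg`-image lies in the input's RADIATION ZONE
`d.radiationZone = Φ '' {late flat domain}` — the anchor from which location propagates by clopen
continuation.  Constant-free by design. -/
def FirstContact {𝓢 : Spacetime.{0} 4} {O : Set 𝓢.carrier} (d : FinalStateDecomposition 𝓢 O 4)
    (i : Fin d.N) (τ₁ : ℝ) (W : ℝ → ℝ) (Ψg : (d.background i).domain → 𝓢.carrier) : Prop :=
  ∀ τ : ℝ, τ₁ < τ → ∃ x : (d.background i).domain,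
    (d.background i).time x.1 = τ ∧ (d.background i).radius x.1 ≤ W (x.1 0) ∧ Ψg x ∈ d.radiationZone

/-- **Thick-wall certificates of the input `(O, d, R₀)`**: for EVERY family of sublinear majorants
`ϱᵢ ≥ ρᵢ` of the excision radii, every hole has a gap certificate whose wall is tied to `ϱᵢ`
(`W ≥ 3ϱᵢ + 2`).  Only LOWER bounds on `W` — the certificate is existential. -/
def ThickWallCerts (𝓢 : Spacetime.{0} 4) (O : Set 𝓢.carrier) (d : FinalStateDecomposition 𝓢 O 4)
    (R₀ : ℝ) : Prop :=
  ∀ ϱ : Fin d.N → ℝ → ℝ, (∀ i, Tendsto (fun s ↦ ϱ i s / s) atTop (𝓝 0)) →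
    (∀ i s, d.excision i s ≤ ϱ i s) →
    ∀ i : Fin d.N, ∃ (R₁ τ₁ : ℝ) (W : ℝ → ℝ) (Ψg : (d.background i).domain → 𝓢.carrier),
      GapCert 𝓢 O d R₀ (ϱ i) i R₁ τ₁ W Ψg

/-- **Contacted thick-wall certificates of the input `(O, d, R₀)`**: as `ThickWallCerts`, each certificate
moreover making FIRST CONTACT with the radiation zone on every late slab. -/
def ContactedCerts (𝓢 : Spacetime.{0} 4) (O : Set 𝓢.carrier) (d : FinalStateDecomposition 𝓢 O 4)
    (R₀ : ℝ) : Prop :=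
  ∀ ϱ : Fin d.N → ℝ → ℝ, (∀ i, Tendsto (fun s ↦ ϱ i s / s) atTop (𝓝 0)) →
    (∀ i s, d.excision i s ≤ ϱ i s) →
    ∀ i : Fin d.N, ∃ (R₁ τ₁ : ℝ) (W : ℝ → ℝ) (Ψg : (d.background i).domain → 𝓢.carrier),
      GapCert 𝓢 O d R₀ (ϱ i) i R₁ τ₁ W Ψg ∧ FirstContact d i τ₁ W Ψg

/-- **NeckCertificate** (v5, token-identical to p131681's `let NeckCertificate`): analysis walls `ρₐᵢ`
(K1), certified radii `Rcᵢ` (K2) swallowing the analysis region (K3), re-gauged hole charts `Ψₐᵢ` — smooth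
open embeddings of the late tubes into `d.charted` (K4), `= Ψᵢ` inside `R₁ + 1` (K5), ONE ATLAS with the
input's undrifted flat chart on `4ρₐᵢ ≤ rᵢ ≤ Rcᵢ + 2` (K6), `C²` certification out to `Rcᵢ` (K7), `C⁰` honesty
and future-directed `Λᵢe₀`-lines on `R₁ ≤ rᵢ ≤ Rcᵢ + 2` (K8/K9), image-disjoint late tubes (K10), relative
closedness (K11), causal covering for compatible thresholds (K12). -/
def NeckCertificate (𝓢 : Spacetime.{0} 4) (O : Set 𝓢.carrier) (d : FinalStateDecomposition 𝓢 O 4)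
    (R₀ : ℝ) : Prop :=
  let B := d.background; let t := fun i ↦ (B i).time; let r := fun i ↦ (B i).radius
  let Λ := fun i ↦ ((d.motion i).1 : E4 ≃L[ℝ] E4); let Φ := d.flatChart; let Ψ := d.chart
  let ρ := d.excision
  ∃ (R₁ τ₁ : ℝ) (ρa Rc : Fin d.N → ℝ → ℝ) (Ψa : ∀ i, (B i).domain → 𝓢.carrier),
    R₀ ≤ R₁ ∧ d.τ₀ ≤ τ₁ ∧
    -- K1: analysis walls (flat-time indexed)
    (∀ i, Monotone (ρa i) ∧ Continuous (ρa i) ∧ Tendsto (fun s ↦ ρa i s / s) atTop (𝓝 0) ∧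
      Tendsto (ρa i) atTop atTop ∧ ∀ s, R₁ + 1 ≤ ρa i s ∧ (τ₁ ≤ s → ρ i s + 1 ≤ ρa i s)) ∧
    -- K2: certified radii (hole-time indexed), exhausting every radius
    (∀ i, Monotone (Rc i) ∧ Continuous (Rc i) ∧ Tendsto (fun s ↦ Rc i s / s) atTop (𝓝 0) ∧
      Tendsto (Rc i) atTop atTop ∧ ∀ s, R₁ + 4 ≤ Rc i s) ∧
    -- K3: the certified tubes swallow the analysis region with margin 3
    (∀ j (y : E4), τ₁ ≤ y 0 → r j y ≤ 9 * ρa j (y 0) → r j y + 3 ≤ Rc j (t j y)) ∧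
    -- K4: the re-gauged charts on the late tubes
    (∀ i, let U : Set (B i).domain := {x | τ₁ < t i x.1 ∧ r i x.1 < Rc i (t i x.1) + 2}
      ContMDiffOn 𝓘(ℝ, E4) (𝓡 4) ∞ (Ψa i) U ∧ IsOpenEmbedding (U.restrict (Ψa i)) ∧
        Ψa i '' U ⊆ d.charted) ∧
    -- K5: near zone untouched
    (∀ i (x : (B i).domain), r i x.1 ≤ R₁ + 1 → Ψa i x = Ψ i x) ∧
    -- K6: ONE ATLAS on the whole analysis collar `4ρa ≤ rᵢ ≤ Rc + 2` (flat-late)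
    (∀ i (y : E4) (hy : y ∈ (B i).domain), τ₁ ≤ y 0 → 4 * ρa i (y 0) ≤ r i y →
      r i y ≤ Rc i (t i y) + 2 → ∃ hy' : y ∈ d.flatDomain, Ψa i ⟨y, hy⟩ = Φ ⟨y, hy'⟩) ∧
    -- K7: C² certification out to Rc (the analytic content)
    (∀ i, Tendsto (fun τ ↦ 𝓢.truncDeviationCk (B i) (Ψa i) 2 (Rc i τ) τ) atTop (𝓝 0)) ∧
    -- K8/K9: C⁰ honesty and future-directed hole time-lines on `R₁ ≤ rᵢ ≤ Rc + 2`
    (∀ i, supCkENorm (Subtype.val '' {x : (B i).domain | τ₁ ≤ t i x.1 ∧ R₁ ≤ r i x.1 ∧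
        r i x.1 ≤ Rc i (t i x.1) + 2}) 0 (𝓢.deviationExtend (B i) (Ψa i)) ≤
      ENNReal.ofReal (1 / (10 * ‖(Λ i : E4 →L[ℝ] E4)‖ ^ 2))) ∧
    (∀ i (x : (B i).domain), τ₁ ≤ t i x.1 → R₁ ≤ r i x.1 → r i x.1 ≤ Rc i (t i x.1) + 2 →
      𝓢.timeOrientation.IsFutureDirected
        (mfderiv 𝓘(ℝ, E4) (𝓡 4) (Ψa i) x ((Λ i) (E4.basisVector 0)))) ∧
    -- K10: images of different holes' late tubes are disjoint
    (∀ i j, i ≠ j → Disjoint (Ψa i '' {x | τ₁ < t i x.1 ∧ r i x.1 < Rc i (t i x.1) + 2})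
      (Ψa j '' {x | τ₁ < t j x.1 ∧ r j x.1 < Rc j (t j x.1) + 2})) ∧
    -- K11: late tube portions (continuous profiles below Rc + 2) are relatively closed in O
    (∀ i (τ' : ℝ) (ϱ : ℝ → ℝ), Continuous ϱ → τ₁ < τ' → (∀ s, ϱ s < Rc i s + 2) →
      closure (Ψa i '' {x | τ' ≤ t i x.1 ∧ r i x.1 ≤ ϱ (t i x.1)}) ∩ O ⊆
        Ψa i '' {x | τ' ≤ t i x.1 ∧ r i x.1 ≤ ϱ (t i x.1)}) ∧
    -- K12: causal covering by the analysis atlas, for every COMPATIBLE choice of late thresholds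
    (∀ (T : ℝ) (Th : Fin d.N → ℝ), τ₁ < T → (∀ j, τ₁ < Th j) →
      (∀ j (y : E4), T < y 0 → r j y ≤ Rc j (t j y) + 2 → Th j < t j y) →
      O \ (Φ '' {y | T < y.1 0 ∧ ∀ j, 5 * ρa j (y.1 0) < r j y.1} ∪
          ⋃ j, Ψa j '' {x | Th j < t j x.1 ∧ r j x.1 < Rc j (t j x.1) + 2}) ⊆
        𝓢.metric.causalPast 𝓢.timeOrientation
          (Φ '' {y | y.1 0 = T ∧ ∀ j, 5 * ρa j (y.1 0) < r j y.1} ∪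
            ⋃ j, Ψa j '' {x | t j x.1 = Th j ∧ r j x.1 < Rc j (t j x.1) + 2}))

/-! ## The three registered stubs -/

/-- **Registered stub 1 — re-excision bootstrap** (M, provable now; the refuter's `ReExcise.lean` device,
evidence on stmt-18060, 2026-08-17T00:28Z).  `NeckGapDecay` is universal over `C⁴` decompositions, so apply
it to `d' := d` re-excised by the majorants `ϱ` (same `N`, masses, motions, `τ₀`, charts, flat domain and
flat chart, hence the same `background`, `region`, `radiationZone`, `charted`; `excision := ϱ`, sublinear by
hypothesis; `setOf_lt_excision_subset_flatDomain` survives because the excluded tubes only grow).  `Hc`, DV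
and `O = exteriorOf 𝒟 d'.charted` are literally those of `d`; `Hf`(1)(3) do not mention the excision and
`Hf`(2) is antitone in it (a larger excision shrinks the far flat slab whose closure is controlled); the
certificate returned for `d'` is a `GapCert … (ϱ i) …` of `d` verbatim (its only excision-dependent clause
is the wall).  Why it might fail: it cannot (pure bookkeeping over the structure); size M in Lean (one
structure literal + defeq transport of three bundles). -/
theorem stub_reExcisionBootstrap : Theses.StarvedNecks.NeckGapDecay →
  ∀ (X : Type) [TopologicalSpace X] [ChartedSpace E3 X] [IsManifold (𝓡 3) ∞ X] [ConnectedSpace X]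
    (D : InitialDataSet (𝓡 3) X), D ∈ admissibleVacuumData X →
    ∀ 𝒟 : VacuumCauchyDevelopment D, 𝒟.IsMaximal →
    ∀ (O : Set 𝒟.carrier) (d : FinalStateDecomposition 𝒟.toSpacetime O 4) (R₀ : ℝ),
      O = exteriorOf 𝒟.toCauchyDevelopment d.charted →
      HonestCore 𝒟.toSpacetime O 4 d R₀ → HonestFar 𝒟.toSpacetime O 4 d R₀ → DistinctVelocities d →
      ThickWallCerts 𝒟.toSpacetime O d R₀ := by
  sorry

/-- **Registered stub 2 — first contact / the anchor** (L, causal–topological, no PDE, no rate).  For every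
admissible datum, MGHD `𝒟`, `C⁴` decomposition `d` of `O = exteriorOf 𝒟 d.charted` with `HonestCore`,
`HonestFar` and distinct velocities: thick-wall certificates for all majorants can be re-chosen (same freedom:
only lower bounds on `W`, `τ₁` as late as needed, majorant enlarged at will) so that every late certified slab
of the gap chart meets the radiation zone (`FirstContact`).  Intended proof (cards `neck-timeline-anchoring`
§(3), `curvature-anchored-location` §(2)(ii)): choose the majorant dominating the input's excision AND the
honest clock offset / drift of `Ψᵢ` against `Φ` (both `o(τ)`), so that the outermost certified sphere
`{rᵢ = W}` sits outside the physical reach `≤ 2(1+ε)ρᵢ` of `Φ`'s excised tube; locate ONE of its points in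
`Φ(late flat)` by the probe curve `γ_b(s) = Ψg(t = s, r = W(s) − 1, ω₀)` (future timelike by G3/G4, infinite
length, inextendible in the globally hyperbolic MGHD, confined to `d.charted = Φ(late flat) ∪ ⋃ⱼ Ψⱼ(lateⱼ)`
by G1), excluding the hole regions along it by the Kretschmann marker (`≥ 40Mⱼ²/(R+1)⁶` on certified near
zones vs `→ 0` on certified-flat and certified-gap far points; `FlatQuietCollarExclusion` pattern,
`Kerr.kretschmannScalar_closedForm`) and the input's far hole leaves by `Hc`(2)(3)/cone separation.  Why it
might fail: far leaves of the INPUT hole charts `Ψⱼ` are unconstrained off their Voronoi cells (`Hf`(3) looks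
only there), so `γ_b` might be swallowed by a wild leaf for all late times — an honest "two-sheeted" input
would refute the stub AS TYPED; then the crux is misstated and the route's recorded repair is the image clause
G6 `Ψg '' {x ∈ U | 2ρᵢ(x⁰)+2 ≤ rᵢ x} ⊆ d.radiationZone` in `NeckGapDecay` (costless for its physics proof),
which makes this stub a one-liner.  Sources: DafermosLuk2017 (Conj. 1 (b)); ONeill1983 Ch. 14 (global
hyperbolicity, time separation); arXiv:0706.0622 §3 (Kretschmann closed form); arXiv:1412.8757. -/
theorem stub_firstContact :
  ∀ (X : Type) [TopologicalSpace X] [ChartedSpace E3 X] [IsManifold (𝓡 3) ∞ X] [ConnectedSpace X]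
    (D : InitialDataSet (𝓡 3) X), D ∈ admissibleVacuumData X →
    ∀ 𝒟 : VacuumCauchyDevelopment D, 𝒟.IsMaximal →
    ∀ (O : Set 𝒟.carrier) (d : FinalStateDecomposition 𝒟.toSpacetime O 4) (R₀ : ℝ),
      O = exteriorOf 𝒟.toCauchyDevelopment d.charted →
      HonestCore 𝒟.toSpacetime O 4 d R₀ → HonestFar 𝒟.toSpacetime O 4 d R₀ → DistinctVelocities d →
      ThickWallCerts 𝒟.toSpacetime O d R₀ → ContactedCerts 𝒟.toSpacetime O d R₀ := by
  sorry

/-- **Registered stub 3 — the contacted seam** (XL, HARDEST, gauge geometry; no PDE, no rate).  For every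
admissible datum, MGHD `𝒟`, `C⁴` decomposition `d` of `O = exteriorOf 𝒟 d.charted` with `HonestCore`,
`HonestFar`, distinct velocities and at least one hole: contacted thick-wall certificates for all sublinear
majorants ⟹ the v5 `NeckCertificate` K1–K12 (token-identical to p131681's).  Intended proof: (i) ENTRY by
anchored clopen continuation from the contact points along the connected late bands (open: `Φ` open
embedding; closed: `Hf`(2) + G5; the coordinate image kept off `{rⱼ ≤ ρⱼ+1}` by the `C⁰` fits and cone
separation), THREADING (the excised tube threads every fitted image sphere, else `Ψᵢ(S_{R₁}) ⊂ Φ(late flat)`,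
excluded by Kretschmann) and bulk VELOCITY DECAY (Landau–Kolmogorov on the confined drift) — giving
`T := Φ⁻¹ ∘ Ψg` on bands `[V, W]` with `W/V → ∞` across the ladder of majorants, drift `O(ϱ)`, bulk boost
`→ 0`, clock offset `o(τ)` with continuous sublinear majorants; (ii) the SWITCH-OFF of the near-`η`-isometry
`T` with `C²` control: mean Poincaré frame tame at every scale (Saint-Venant identity for the constant form
`η` + Stokes telescoping, card `stokes-mean-frame-rigidity`), sub-mean vortex/flash structure switched off
INSIDE the group (fractional amplitude / frame-geodesic interpolation + div–curl corrector, cards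
`vortex-foam-switch-off`, `cone-pinched-rigidity-mollified-seam`), paying displacement/width — whence the walls
`ρₐ ≫` drift and the one atlas beyond `4ρₐ` (K1, K5, K6, K7); (iii) chart assembly K2–K4, K8, K9 (open
embedding of the blended chart, `C⁰` honesty and future lines on the collar from the flat certificate + Kerr
tail `KerrSchildTailDecay` + the timecone); (iv) K10 by cone separation (p106992 — the one use of DV) +
injectivity of `Φ` + Kretschmann exclusion of cross terms, K11 from G5/`Hf`(2) transport, K12 from `Hc`(2) +
clock comparison on honest annuli (`flatTime_mem_Icc`, `abs_flatTime_sub_le`) + the input covering clause.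
Refuted devices NOT used (NegativeNotes r1k1 (D)(E)): sup-`C¹` closeness of `T` to one Poincaré map, a
pointwise `‖DT‖` bound, an all-scale mollified/fitted seam.  Why it might fail: the WOUND regime — relative
twist `δ₀ log(range)` unbounded faster than the bootstrap's room can pay (`SwitchOffUniform` open in that
regime; its failure would make K5–K7 unsatisfiable for an honest input and the crux refuted-misstated, repair =
a certification rate beating `π/log t`), or hidden wild far leaves of the input hole charts in K12.  Sources:
FrieseckeJamesMuller2002; F. John, CPAM 14 (1961) 391 (doi:10.1002/cpa.3160140316); ONeill1983;
DafermosLuk2017; arXiv:2104.08222 §1. -/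
theorem stub_contactedSeam :
  ∀ (X : Type) [TopologicalSpace X] [ChartedSpace E3 X] [IsManifold (𝓡 3) ∞ X] [ConnectedSpace X]
    (D : InitialDataSet (𝓡 3) X), D ∈ admissibleVacuumData X →
    ∀ 𝒟 : VacuumCauchyDevelopment D, 𝒟.IsMaximal →
    ∀ (O : Set 𝒟.carrier) (d : FinalStateDecomposition 𝒟.toSpacetime O 4) (R₀ : ℝ),
      O = exteriorOf 𝒟.toCauchyDevelopment d.charted →
      HonestCore 𝒟.toSpacetime O 4 d R₀ → HonestFar 𝒟.toSpacetime O 4 d R₀ → DistinctVelocities d →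
      0 < d.N → ContactedCerts 𝒟.toSpacetime O d R₀ → NeckCertificate 𝒟.toSpacetime O d R₀ := by
  sorry

/-! ## Registered stub signatures (by name, for `ledger skeleton check` / `#h21_check_skeleton`)

As in the v5 skeleton (`Cruxes/NecksCertify/Lines/two_cap_focusing_ledger.lean`, `namespace Registered`): each
`Registered.stub_<name>` is the statement of the theorem `stub_<name>` above, verbatim, so that the composition
`GapDecaySuffices_of` takes its hypotheses BY NAME. -/
namespace Registered

/-- Registered signature of `stub_reExcisionBootstrap` (verbatim). -/
abbrev stub_reExcisionBootstrap : Prop :=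
  Theses.StarvedNecks.NeckGapDecay →
  ∀ (X : Type) [TopologicalSpace X] [ChartedSpace E3 X] [IsManifold (𝓡 3) ∞ X] [ConnectedSpace X]
    (D : InitialDataSet (𝓡 3) X), D ∈ admissibleVacuumData X →
    ∀ 𝒟 : VacuumCauchyDevelopment D, 𝒟.IsMaximal →
    ∀ (O : Set 𝒟.carrier) (d : FinalStateDecomposition 𝒟.toSpacetime O 4) (R₀ : ℝ),
      O = exteriorOf 𝒟.toCauchyDevelopment d.charted →
      HonestCore 𝒟.toSpacetime O 4 d R₀ → HonestFar 𝒟.toSpacetime O 4 d R₀ → DistinctVelocities d →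
      ThickWallCerts 𝒟.toSpacetime O d R₀

/-- Registered signature of `stub_firstContact` (verbatim). -/
abbrev stub_firstContact : Prop :=
  ∀ (X : Type) [TopologicalSpace X] [ChartedSpace E3 X] [IsManifold (𝓡 3) ∞ X] [ConnectedSpace X]
    (D : InitialDataSet (𝓡 3) X), D ∈ admissibleVacuumData X →
    ∀ 𝒟 : VacuumCauchyDevelopment D, 𝒟.IsMaximal →
    ∀ (O : Set 𝒟.carrier) (d : FinalStateDecomposition 𝒟.toSpacetime O 4) (R₀ : ℝ),
      O = exteriorOf 𝒟.toCauchyDevelopment d.charted →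
      HonestCore 𝒟.toSpacetime O 4 d R₀ → HonestFar 𝒟.toSpacetime O 4 d R₀ → DistinctVelocities d →
      ThickWallCerts 𝒟.toSpacetime O d R₀ → ContactedCerts 𝒟.toSpacetime O d R₀

/-- Registered signature of `stub_contactedSeam` (verbatim). -/
abbrev stub_contactedSeam : Prop :=
  ∀ (X : Type) [TopologicalSpace X] [ChartedSpace E3 X] [IsManifold (𝓡 3) ∞ X] [ConnectedSpace X]
    (D : InitialDataSet (𝓡 3) X), D ∈ admissibleVacuumData X →
    ∀ 𝒟 : VacuumCauchyDevelopment D, 𝒟.IsMaximal →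
    ∀ (O : Set 𝒟.carrier) (d : FinalStateDecomposition 𝒟.toSpacetime O 4) (R₀ : ℝ),
      O = exteriorOf 𝒟.toCauchyDevelopment d.charted →
      HonestCore 𝒟.toSpacetime O 4 d R₀ → HonestFar 𝒟.toSpacetime O 4 d R₀ → DistinctVelocities d →
      0 < d.N → ContactedCerts 𝒟.toSpacetime O d R₀ → NeckCertificate 𝒟.toSpacetime O d R₀

end Registered

/-- The registered signatures ARE the statements of the three `stub_*` theorems (checked by ascription; these three
`example`s elaborate no `sorry` of their own). -/
example : Registered.stub_reExcisionBootstrap := stub_reExcisionBootstrap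
example : Registered.stub_firstContact := stub_firstContact
example : Registered.stub_contactedSeam := stub_contactedSeam

/-! ## The composition: the crux BY NAME from the three stub statements (no `sorry`) -/

set_option maxHeartbeats 1600000 in
/-- **`GapDecaySuffices` from the three stubs, BY NAME** (hypotheses = `Registered.stub_*`, the verbatim statements
of the three `stub_*` theorems; pure logic over the landed reduction p131681): given
`NeckGapDecay`, the bootstrap yields thick-wall certificates for every honest input, first contact anchors
them, the contacted seam turns them into a `NeckCertificate` whenever `0 < d.N`, and
`necksCertifyR_of_neckLedgerAnalysisPos` (whose bundles are token-identical to this file's) concludes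
`NecksCertifyR`.  The model antecedents `HuygensNeckLemma`, `KirchhoffFormula` of that reduction are not
needed by the gauge half and are discarded. -/
theorem GapDecaySuffices_of
    (h₁ : Registered.stub_reExcisionBootstrap) (h₂ : Registered.stub_firstContact)
    (h₃ : Registered.stub_contactedSeam) :
    Theses.StarvedNecks.GapDecaySuffices := by
  intro hgap
  refine Theorems.NecksCertifyRRelations.necksCertifyR_of_neckLedgerAnalysisPos ?_
  intro _hHuygens _hKirchhoff X _ _ _ _ D hD 𝒟 h𝒟 O d R₀ hO hc hf hdv hN
  have hthick : ThickWallCerts 𝒟.toSpacetime O d R₀ := h₁ hgap X D hD 𝒟 h𝒟 O d R₀ hO hc hf hdv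
  have hcontact : ContactedCerts 𝒟.toSpacetime O d R₀ := h₂ X D hD 𝒟 h𝒟 O d R₀ hO hc hf hdv hthick
  exact h₃ X D hD 𝒟 h𝒟 O d R₀ hO hc hf hdv hN hcontact

/-! ## Hand-over sanity: `NeckGapDecay`'s body IS `GapCert … (d.excision i) …` (definitional) -/

/-- `NeckGapDecay` delivers, for every honest input and hole, a `GapCert` with the wall tied to the input's
own excision radius — by `exact` (token-identical bodies).  Recorded so that the bootstrap's prover sees the
hand-over costs nothing. -/
theorem gapCert_of_neckGapDecay (hgap : Theses.StarvedNecks.NeckGapDecay) :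
  ∀ (X : Type) [TopologicalSpace X] [ChartedSpace E3 X] [IsManifold (𝓡 3) ∞ X] [ConnectedSpace X]
    (D : InitialDataSet (𝓡 3) X), D ∈ admissibleVacuumData X →
    ∀ 𝒟 : VacuumCauchyDevelopment D, 𝒟.IsMaximal →
    ∀ (O : Set 𝒟.carrier) (d : FinalStateDecomposition 𝒟.toSpacetime O 4) (R₀ : ℝ),
      O = exteriorOf 𝒟.toCauchyDevelopment d.charted →
      HonestCore 𝒟.toSpacetime O 4 d R₀ → HonestFar 𝒟.toSpacetime O 4 d R₀ → DistinctVelocities d →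
      ∀ i : Fin d.N, ∃ (R₁ τ₁ : ℝ) (W : ℝ → ℝ) (Ψg : (d.background i).domain → 𝒟.carrier),
        GapCert 𝒟.toSpacetime O d R₀ (d.excision i) i R₁ τ₁ W Ψg := by
  intro X _ _ _ _ D hD 𝒟 h𝒟 O d R₀ hO hc hf hdv i
  exact hgap X D hD 𝒟 h𝒟 O d R₀ hO hc hf hdv i

end Summit.FinalStateConjecture.FinalStateConjecture.Cruxes.GapDecaySuffices.Birth

end
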